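import Literature.NumberTheory.EllipticCurves.NewformCountMartinBoundProofs
import Literature.NumberTheory.EllipticCurves.PastenValuationProductThm75ExplicitProofs
import Literature.NumberTheory.EllipticCurves.ModularDegreeSpectralLevelBoundProofs
import Literature.NumberTheory.EllipticCurves.PeriodRelationsProofs
import Literature.NumberTheory.EllipticCurves.DeligneHeckeEigenvalueBound
import HarnessLib

/-!
# Pasten 2024, Prop 7.1 at `D = 1` PROVED, and the EXPLICIT clauses of Thm 7.2 / Thm 7.5 reduced to
# the weight-two Hasse–Weil bound alone (proofs)

Topic `Literature/NumberTheory/EllipticCurves` (family `abc`, LADDER-ABC A1, the *modular method*;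
cell abc-stewartyu, seat lit-abc-pasten g4). Theorems only — NO new statement, NO new named fact
(D-0026). Source: H. Pasten, *Shimura curves and the abc conjecture*, J. Number Theory **254** (2024)
= arXiv:1705.09251v4 [`PastenShimura2024`], §7.1 Prop 7.1 and §7.2 Thm 7.2 (arXiv p. 26), §7.4
Thm 7.5 (p. 27).

## The point

Every explicit `D = 1` consumer of Pasten's §7 in the tree (`log_modularDegree_le_of_thm_5_5`,
`pasten_thm_7_5_explicit_of_modularity_of_thm_5_5` of `PastenValuationProductThm75ExplicitProofs.lean`;
`PastenShimura2024_thm_7_5_height_explicit_of_thm_7_2` of `ModularDegreeSpectralLevelBoundProofs.lean`)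
carried Prop 7.1 as the un-vendored hypothesis `hr`:

> `hr : Σ_{c ≠ [χ₀]} #c ≤ N/12 + (7/12) d(N²)` ("Prop 7.1 as used on p. 26: `r_{1,N} − 1`;
> G. Martin's dimension bound; NOT in the tree"),

with the classes `c ≠ [χ₀]` read as the minimal primes `P ≠ 𝕀_{[χ₀]}` of `𝕋 = anemicHeckeRing N 2`
and `#c = rank_ℤ(𝕋 ⧸ P)`. Meanwhile the von Känel–Matschke typing seat PROVED G. Martin's bound in
the form vKM use it (`NewformCountMartinBoundProofs.lean`, `twelve_mul_newformCount_le`: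
`12 · m(N) ≤ ν(N) + 1` for `N ≥ 2`, `m(N) = Σ_{M ∣ N} dim S₂^{new}(Γ₀(M)) = r_{1,N}`,
`ν(N) = N ∏_{p² ∣ N}(1 − p⁻²) ≤ N`; Atkin–Lehner count + genus formula + Möbius inversion, all
theorems of the tree). This file joins the two: `Σ_{P ≠ 𝕀} rank(𝕋 ⧸ P) ≤ Σ_P rank(𝕋 ⧸ P) ≤ m(N)`
(`sum_finrank_quotient_minimalPrimes_le_moebius_sum` + `newformCount_eq_moebius_sum`), so

  `Σ_{c ≠ [χ₀]} #c ≤ (N + 1)/12 ≤ N/12 + (7/12) d(N²)`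

— Pasten's Prop 7.1 at `D = 1` **PROVED** (indeed in vKM's sharper form), and with it:

* `PastenShimura2024_thm_7_2_explicit_of_weight_two_bound` — **Thm 7.2, explicit clause, `D = 1`**
  (the named fact `PastenShimura2024_thm_7_2_explicit`:
  `log δ_{1,N} ≤ ((1/12) N + (7/12) d(N²)) (log N + 4 log N / log log N)`) from the SINGLE hypothesis
  "the eigenvalues of `T_p` (`p ∤ N`) on `S₂(Γ₀(N))` have absolute value `≤ 2√p`" (the weight-`2`
  Ramanujan–Petersson bound = Hasse–Weil for the attached abelian varieties; Pasten p. 26: "the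
  Hasse–Weil bound on the Fourier coefficients of a normalized eigenform of weight 2"); and
  `PastenShimura2024_thm_7_2_explicit_of_deligne` — the same from the tree's named fact
  `Deligne1974_heckeT_eigenvalue_norm_le` (its weight-`2` case). Everything else of the printed proof
  (Thm 5.5 `PastenShimura2024_thm_5_5_holds`, Sturm's bound, Robin's divisor bound, Prop 7.1) is a
  theorem of the tree.
* `pasten_thm_7_5_explicit_of_modularity_mazurKenku_deligne` — **Thm 7.5, explicit discriminant
  clause** (`pasten_thm_7_5_explicit`: `log|Δ_E| ≤ ½ (N + 7 d(N²)) (log N + 4 log N/log log N) + 124`)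
  from {`nonempty_modularParametrizationData`, `PastenShimura2024_minimalDegree_le_163_mul`,
  `Deligne1974_heckeT_eigenvalue_norm_le`} — the same trust base as the asymptotic rung's
  `pasten_thm_7_5_of_modularity_mazurKenku_deligne_murty` minus Murty's Lemma 11.
* `PastenShimura2024_thm_7_5_height_explicit_of_deligne` — **Thm 7.5, explicit height clause**
  (`h(E) ≤ (1/24)(N + 7 d(N²))(log N + 4 log N/log log N) + 9`) from the same three facts and Carayol's
  "level = conductor" (`IsNewformOf.level_eq_conductorNorm`, needed only because the fact pins the
  level to the conductor; hypothesis `hlev` as in `PastenShimura2024_thm_7_5_height_explicit_of_thm_7_2`).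

WHAT THIS IS NOT: no discharge (the weight-`2` Hasse–Weil bound — Eichler–Shimura–Igusa–Weil — is a
named fact of the tree, not a theorem); the `D > 1` clauses (`r_{D,M}` on `𝕋_{D,M}`) have no carrier;
no claim on `abc`.

## References

* [PastenShimura2024] H. Pasten, J. Number Theory 254 (2024) = arXiv:1705.09251v4: Prop. 7.1 and Thm 7.2
  with its proof (p. 26), Thm 7.5 (p. 27).
* [Martin2005NewformDimensions] G. Martin, J. Number Theory 112 (2005), Thm. 1 and Lemma 17 (Pasten's
  [GregMartin]); in the tree through `twelve_mul_newformCount_le`.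
* [VonkanelMatschke2023] R. von Känel, B. Matschke, Mem. AMS 286 (2023), §10.5.3 (eq:martinbound).
* [Deligne1974] P. Deligne, Publ. Math. IHÉS 43 (1974), Thm. (8.2).
-/

noncomputable section

open scoped MatrixGroups ModularForm

open WeierstrassCurve CongruenceSubgroup UpperHalfPlane

namespace Literature.NumberTheory.EllipticCurves

open ModularForms Pasten2024

namespace Pasten2024

variable {N : ℕ} [NeZero N] {W : WeierstrassCurve ℚ}

/-- **`Σ_{c ≠ [χ₀]} #c ≤ m(N) = r_{1,N}`**: the classes `c ≠ [χ₀]` (minimal primes `P ≠ 𝕀_f` of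
`𝕋 = anemicHeckeRing N 2`, `#c = rank_ℤ(𝕋 ⧸ P)`) number at most the newforms of level dividing `N`
counted with Galois multiplicity: `Σ_P rank(𝕋 ⧸ P) ≤ Σ_{ab = N} μ(a) dim S₂(Γ₀(b)) = m(N)`
(`sum_finrank_quotient_minimalPrimes_le_moebius_sum`, `newformCount_eq_moebius_sum`). Pasten §7.1:
"`r_{D,M} = Σ_c #c`". [cite: PastenShimura2024, §7.1 (r_{D,M}) and proof of Thm 7.2 ("r_{D,M} = Σ_c #c"), arXiv p. 26] -/
theorem sum_erase_finrank_quotient_le_newformCount (D : ModularParametrizationData W N) :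
    (∑ P ∈ (finite_minimalPrimes_anemicHeckeRing N 2).toFinset.erase (eigenIdeal D.f),
        (Module.finrank ℤ (anemicHeckeRing N 2 ⧸ P) : ℝ)) ≤ (newformCount N : ℝ) := by
  have h0 : (∑ P ∈ (finite_minimalPrimes_anemicHeckeRing N 2).toFinset.erase (eigenIdeal D.f),
      (Module.finrank ℤ (anemicHeckeRing N 2 ⧸ P) : ℝ)) ≤
      ((∑ P ∈ (finite_minimalPrimes_anemicHeckeRing N 2).toFinset,
          Module.finrank ℤ (anemicHeckeRing N 2 ⧸ P) : ℕ) : ℝ) := by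
    rw [Nat.cast_sum]
    exact Finset.sum_le_sum_of_subset_of_nonneg (Finset.erase_subset _ _)
      fun _ _ _ => Nat.cast_nonneg _
  have h1 := sum_finrank_quotient_minimalPrimes_le_moebius_sum N 2
  have h2 := newformCount_eq_moebius_sum (NeZero.ne N)
  have h3 : ((∑ P ∈ (finite_minimalPrimes_anemicHeckeRing N 2).toFinset,
      Module.finrank ℤ (anemicHeckeRing N 2 ⧸ P) : ℕ) : ℤ) ≤ (newformCount N : ℤ) := by
    rw [h2]; exact h1
  have h3' : ((∑ P ∈ (finite_minimalPrimes_anemicHeckeRing N 2).toFinset,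
      Module.finrank ℤ (anemicHeckeRing N 2 ⧸ P) : ℕ) : ℝ) ≤ (newformCount N : ℝ) := by
    exact_mod_cast h3
  exact h0.trans h3'

/-- **Prop 7.1 at `D = 1`, in von Känel–Matschke's sharper form**: `Σ_{c ≠ [χ₀]} #c ≤ (N + 1)/12`
for every datum at level `N` (`m(N) ≤ (ν(N) + 1)/12`, `twelve_mul_newformCount_le`, G. Martin's formula
via the Atkin–Lehner count; `ν(N) ≤ N`, `condNu_le_self`; a datum forces `N ≥ 11`, `eleven_le_level`).
[cite: PastenShimura2024, Prop. 7.1 (D = 1), arXiv p. 26] [cite: VonkanelMatschke2023, §10.5.3 (eq:martinbound)] -/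
theorem sum_erase_finrank_quotient_le_succ_div_twelve (D : ModularParametrizationData W N) :
    (∑ P ∈ (finite_minimalPrimes_anemicHeckeRing N 2).toFinset.erase (eigenIdeal D.f),
        (Module.finrank ℤ (anemicHeckeRing N 2 ⧸ P) : ℝ)) ≤ ((N : ℝ) + 1) / 12 := by
  have h11 : 11 ≤ N := eleven_le_level D
  have hm := twelve_mul_newformCount_le (N := N) (by omega)
  have hν : condNu N ≤ N := condNu_le_self N
  have hS := sum_erase_finrank_quotient_le_newformCount D
  rw [le_div_iff₀ (by norm_num : (0 : ℝ) < 12)]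
  linarith

/-- **Pasten 2024, Proposition 7.1 at `D = 1`, as used in the proof of Thm 7.2 (p. 26) — PROVED**:
`Σ_{c ≠ [χ₀]} #c ≤ N/12 + (7/12) d(N²)` (i.e. `r_{1,N} − 1 ≤ N/12 + (7/12) d(N²)`; Pasten:
"`r_{D,M} ≤ (1/12) φ(D) M + (7/12) d(DM²) + 1`", from G. Martin's
`s(n) ≤ φ(n)/12 + (7/12) 2^{ω(n)} + μ(n)`). This is the hypothesis `hr` of
`log_modularDegree_le_of_thm_5_5` / `pasten_thm_7_5_explicit_of_modularity_of_thm_5_5`, verbatim.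
Over the tree it follows from the sharper `(N + 1)/12` (`d(N²) ≥ 1`).
[cite: PastenShimura2024, Prop. 7.1 (D = 1) and proof of Thm 7.2, arXiv p. 26] [cite: Martin2005NewformDimensions, Thm. 1 with Lemma 17] -/
theorem prop_7_1_levelOne (N : ℕ) [NeZero N] (W : WeierstrassCurve ℚ) [W.IsElliptic]
    (D : ModularParametrizationData W N) :
    (∑ P ∈ (finite_minimalPrimes_anemicHeckeRing N 2).toFinset.erase (eigenIdeal D.f),
        (Module.finrank ℤ (anemicHeckeRing N 2 ⧸ P) : ℝ)) ≤
      (N : ℝ) / 12 + 7 / 12 * ((N ^ 2).divisors.card : ℝ) := by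
  have h := sum_erase_finrank_quotient_le_succ_div_twelve D
  have hN0 : N ^ 2 ≠ 0 := pow_ne_zero 2 (NeZero.ne N)
  have hd : (1 : ℝ) ≤ ((N ^ 2).divisors.card : ℝ) := by
    have : 1 ≤ (N ^ 2).divisors.card :=
      Finset.card_pos.mpr ⟨1, Nat.one_mem_divisors.mpr hN0⟩
    exact_mod_cast this
  linarith

end Pasten2024

/-! ### Thm 7.2 (explicit, `D = 1`) from the weight-two Hasse–Weil bound alone -/

/-- **Pasten 2024, Thm 7.2, explicit clause at `D = 1`, from the weight-`2` Ramanujan–Petersson bound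
alone** (PROVED reduction of the named fact `PastenShimura2024_thm_7_2_explicit`): if every eigenvalue
`μ` of `T_p` (`p ∤ N` prime) on `S₂(Γ₀(N))` has `|μ| ≤ 2√p` ("the Hasse–Weil bound on the Fourier
coefficients of a normalized eigenform of weight `2`", p. 26), then for every `E/ℚ` of conductor `N`
and every optimal datum, `log δ_{1,N} ≤ ((1/12) N + (7/12) d(N²)) (log N + 4 log N / log log N)`.
Thm 5.5 (`PastenShimura2024_thm_5_5_holds`), the size bound
`PastenShimura2024_log_heckeCongruenceModulus_lt_of_weight_two_bound` (Sturm, Robin) and Prop 7.1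
(`Pasten2024.prop_7_1_levelOne`) are theorems of the tree. [cite: PastenShimura2024, Thm 7.2 (explicit clause, D = 1) and its proof, arXiv p. 26] -/
theorem PastenShimura2024_thm_7_2_explicit_of_weight_two_bound
    (h2 : ∀ (N : ℕ) [NeZero N] (p : ℕ) [NeZero p], p.Prime → ¬ p ∣ N → ∀ μ : ℂ,
      Module.End.HasEigenvalue (heckeT (Gamma0 N) 2 p) μ → ‖μ‖ ≤ 2 * Real.sqrt p) :
    PastenShimura2024_thm_7_2_explicit := by
  intro N _ W _ D _ hmin
  have h := log_modularDegree_le_of_thm_5_5 PastenShimura2024_thm_5_5_holds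
    (PastenShimura2024_log_heckeCongruenceModulus_lt_of_weight_two_bound h2)
    (fun N _ W _ D => Pasten2024.prop_7_1_levelOne N W D) D hmin
  have e : (N : ℝ) / 12 = (1 / 12 : ℝ) * N := by ring
  rw [e] at h
  exact h

/-- **Pasten 2024, Thm 7.2, explicit clause at `D = 1`, from Deligne's bound** (the tree's named fact
`Deligne1974_heckeT_eigenvalue_norm_le`, weight-`2` case): `PastenShimura2024_thm_7_2_explicit` holds.
[cite: PastenShimura2024, Thm 7.2 (explicit clause, D = 1), arXiv p. 26] [cite: Deligne1974, Thm. 8.2] -/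
theorem PastenShimura2024_thm_7_2_explicit_of_deligne (hDel : Deligne1974_heckeT_eigenvalue_norm_le) :
    PastenShimura2024_thm_7_2_explicit :=
  PastenShimura2024_thm_7_2_explicit_of_weight_two_bound
    (Deligne1974_heckeT_eigenvalue_norm_le.weight_two hDel)

/-! ### Thm 7.5 (explicit clauses) from modularity, Mazur–Kenku and Deligne -/

/-- **Pasten 2024, Thm 7.5, explicit discriminant clause** (the named fact `pasten_thm_7_5_explicit`:
`log|Δ_E| ≤ ½ (N + 7 d(N²)) (log N + 4 log N / log log N) + 124` for every `E/ℚ`) **from three named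
facts**: modularity with an integral Manin constant (`nonempty_modularParametrizationData`),
Mazur–Kenku (`PastenShimura2024_minimalDegree_le_163_mul`) and Deligne's bound (weight `2`). The
sibling's `pasten_thm_7_5_explicit_of_modularity_of_thm_5_5` with its two remaining hypotheses
discharged: Thm 5.5 (`PastenShimura2024_thm_5_5_holds`) and Prop 7.1 (`Pasten2024.prop_7_1_levelOne`).
[cite: PastenShimura2024, Thm 7.5 (explicit clause; proof §7.4, arXiv p. 27)] -/
theorem pasten_thm_7_5_explicit_of_modularity_mazurKenku_deligne
    (hmod : nonempty_modularParametrizationData) (h163 : PastenShimura2024_minimalDegree_le_163_mul)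
    (hDel : Deligne1974_heckeT_eigenvalue_norm_le) : pasten_thm_7_5_explicit :=
  pasten_thm_7_5_explicit_of_modularity_of_thm_5_5 hmod h163 PastenShimura2024_thm_5_5_holds hDel
    fun N _ W _ D => Pasten2024.prop_7_1_levelOne N W D

/-- **Pasten 2024, Thm 7.5, explicit height clause** (the named fact
`PastenShimura2024_thm_7_5_height_explicit`: `h(E) ≤ (1/24)(N + 7 d(N²))(log N + 4 log N / log log N) + 9`)
from modularity, Mazur–Kenku, Deligne's weight-`2` bound and Carayol's "level = conductor"
(`IsNewformOf.level_eq_conductorNorm`, hypothesis `hlev`, needed because the explicit Thm 7.2 is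
recorded with the level pinned to the conductor): `PastenShimura2024_thm_7_5_height_explicit_of_thm_7_2`
fed with `PastenShimura2024_thm_7_2_explicit_of_deligne`.
[cite: PastenShimura2024, Thm 7.5 (explicit height clause; proof §7.4, arXiv p. 27)] -/
theorem PastenShimura2024_thm_7_5_height_explicit_of_deligne
    (hmod : nonempty_modularParametrizationData) (h163 : PastenShimura2024_minimalDegree_le_163_mul)
    (hlev : ∀ (N : ℕ) [NeZero N], IsNewformOf.level_eq_conductorNorm (N := N))
    (hDel : Deligne1974_heckeT_eigenvalue_norm_le) : PastenShimura2024_thm_7_5_height_explicit :=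
  PastenShimura2024_thm_7_5_height_explicit_of_thm_7_2 hmod h163 hlev
    (PastenShimura2024_thm_7_2_explicit_of_deligne hDel)

end Literature.NumberTheory.EllipticCurves

end
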